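import Summits.ABC.StewartYu.PadicG3ParD
import HarnessLib

/-!
# The `p`-adic Gen-3 parameter record — part E: the conditioning allowance and the master inequalities (B3)/(B4)/(C0)

Support file (plain theorems; no named facts). Continues `PadicG3ParD` (K-M3.1 page
HOME/p1/K-M3-1-padic-ledger.md §4; HOME/p1/D-m0-record-budget.md). With `Z = G·X·L`:
* `Acond s ν ≤ 2^ν Z/(n+1) + 0.27 Z` (`ν ≤ n`): the U-branch conditioning `N t + t log 2N + T_s`
  (`N = 2^{ν+1} X_s + 1` nodes of multiplicity `t = T_s + 1`; `condExp·log p ≤ N t log p/(p−1) + t log 2N`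
  and `log p ≤ p − 1`);
* `small_le`: `2·yload + G + 2H + 8 ≤ Z/500`;
* **(B3) `kstep_budget`**: `AY + logK ν + 1 ≤ zeros s ν` — every level `s`, every stage `ν` (Schwarz branch of
  the k-step: big-disc `Y₀` growth + the Liouville constant fit under the `≥ (31/4)·2^ν·Z` zeros·gain);
* **(B4) `halfstep_budget`**: `AY + 2ⁿ·(logK 0 + 1) ≤ zeros s n` (degree-`2ⁿ` Liouville at the half points);
* **(C0) `order_budget` / `order_budget₁`**: for every `U ≥ 8·2ⁿ·Z` (the frame's negated bound in
  height·log units), `AY + Acond s ν + 2ⁿ(logK 0 + 1) < U`, resp. with the unit-disc allowance `AY1`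
  (`6·2ⁿ` suffices numerically; the landed `U₀ = ⌈(9/2)·2ⁿ·θ_m·X·L⌉₊ + 1` is NOT claimed sufficient —
  see D-m0-record-budget.md §2–§3 for what is `G`-typed here).
WHAT THIS IS NOT: the frames' k-step theorems; the headline `U ≤ C(n)·(p/log p)·Ω·W⁺`.

## References
* [Nesterenko2003] Yu. V. Nesterenko, *Linear forms in logarithms of rational numbers*, LNM 1819
  (2003) 53–106 — §4.2 (4.29)–(4.35), §4.3 (4.39)–(4.45).
-/

noncomputable section

open Finset Real

namespace Summit.ABC.StewartYu

namespace PadicG3Par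

variable {n : ℕ} (P : PadicG3Par n)

/-! ### The conditioning allowance -/

/-- (a) `N · t ≤ 2^ν Z/(n+1) + Z/128` for `N = 2^{ν+1} X_s + 1`, `t = T_s + 1`. [folklore] -/
theorem Acond_nodes_le (s ν : ℕ) :
    (2 ^ (ν + 1) * (P.Xs s : ℝ) + 1) * (P.T s + 1) ≤
      2 ^ ν * (P.G * P.X * P.L) / (n + 1) + P.G * P.X * P.L / 128 := by
  have hXs := P.Xs_mul_le s
  have hT : (P.T s : ℝ) ≤ 8 * P.L := by exact_mod_cast P.T_le s
  have hL := P.L_le_GXL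
  have hL1 : (1 : ℝ) ≤ P.L := P.one_le_L
  have hG : 8 * ((n : ℝ) + 1) ≤ P.G := by have h8 := P.cG_mul_le_G; simp only [cG] at h8; linarith
  have hn1 : (0 : ℝ) < n + 1 := by positivity
  have h2ν : (0 : ℝ) ≤ 2 ^ ν := by positivity
  have hXL0 : 0 ≤ (P.X : ℝ) * P.L := by positivity
  have hXL : 8 * ((P.X : ℝ) * P.L) ≤ P.G * P.X * P.L / (n + 1) := by
    rw [le_div_iff₀ hn1]
    nlinarith
  have e : (2 ^ (ν + 1) * (P.Xs s : ℝ) + 1) * (P.T s + 1) =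
      2 ^ ν * (2 * ((P.Xs s : ℝ) * (P.T s + 1))) + (P.T s + 1) := by rw [pow_succ]; ring
  rw [e]
  have h1 : 2 * ((P.Xs s : ℝ) * (P.T s + 1)) ≤ P.G * P.X * P.L / (n + 1) := by linarith
  have h3 : (2 : ℝ) ^ ν * (2 * ((P.Xs s : ℝ) * (P.T s + 1))) ≤ 2 ^ ν * (P.G * P.X * P.L / (n + 1)) :=
    mul_le_mul_of_nonneg_left h1 h2ν
  have e2 : (2 : ℝ) ^ ν * (P.G * P.X * P.L / (n + 1)) = 2 ^ ν * (P.G * P.X * P.L) / (n + 1) := by ring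
  linarith

/-- (b) `log 2N ≤ (ν+5) log 2 + log X + log L`. [folklore] -/
theorem Acond_log_le (s ν : ℕ) :
    Real.log (2 * (2 ^ (ν + 1) * (P.Xs s : ℝ) + 1)) ≤ (ν + 5) * Real.log 2 + Real.log P.X + Real.log P.L := by
  have hXs := P.Xs_mul_le s
  have hXs0 : (0 : ℝ) ≤ P.Xs s := by positivity
  have hT0 : (0 : ℝ) ≤ P.T s := by positivity
  have hL1 : (1 : ℝ) ≤ P.L := P.one_le_L
  have hX := P.seventytwo_le_X
  have hXs' : (P.Xs s : ℝ) ≤ 4 * P.X * P.L := by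
    calc (P.Xs s : ℝ) = P.Xs s * 1 := (mul_one _).symm
      _ ≤ P.Xs s * (P.T s + 1) := mul_le_mul_of_nonneg_left (by linarith) hXs0
      _ ≤ _ := hXs
  have hXL1 : (1 : ℝ) ≤ P.X * P.L := by nlinarith
  have hN : 2 * (2 ^ (ν + 1) * (P.Xs s : ℝ) + 1) ≤ 2 ^ (ν + 5) * (P.X * P.L) := by
    rw [show (2 : ℝ) ^ (ν + 5) = 2 ^ (ν + 1) * 16 by ring]
    have h2 : (0 : ℝ) ≤ 2 ^ (ν + 1) := by positivity
    have h21 : (1 : ℝ) ≤ 2 ^ (ν + 1) := one_le_pow₀ (by norm_num)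
    nlinarith
  have hpos : 0 < 2 * (2 ^ (ν + 1) * (P.Xs s : ℝ) + 1) := by positivity
  calc Real.log (2 * (2 ^ (ν + 1) * (P.Xs s : ℝ) + 1)) ≤ Real.log (2 ^ (ν + 5) * (P.X * P.L)) :=
        Real.log_le_log hpos hN
    _ = (ν + 5) * Real.log 2 + Real.log P.X + Real.log P.L := by
        rw [Real.log_mul (by positivity) (by positivity), Real.log_pow,
          Real.log_mul (by positivity) (by positivity)]
        push_cast; ring

/-- (c) `t · log 2N ≤ Z/4` for `ν ≤ n`. [folklore] -/
theorem Acond_tlog_le (s : ℕ) {ν : ℕ} (hν : ν ≤ n) :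
    ((P.T s : ℝ) + 1) * Real.log (2 * (2 ^ (ν + 1) * (P.Xs s : ℝ) + 1)) ≤ (25 / 100) * (P.G * P.X * P.L) := by
  have hlogN := P.Acond_log_le s ν
  have hT : (P.T s : ℝ) ≤ 8 * P.L := by exact_mod_cast P.T_le s
  have hL1 : (1 : ℝ) ≤ P.L := P.one_le_L
  have hn : (1 : ℝ) ≤ n := by exact_mod_cast P.hn
  have hG16 := P.sixteen_le_G
  have hl2 : Real.log 2 ≤ 6932 / 10000 := by have := Real.log_two_lt_d9; linarith
  have hl20 : 0 ≤ Real.log 2 := Real.log_nonneg (by norm_num)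
  have hνn : (ν : ℝ) ≤ n := by exact_mod_cast hν
  have hlX := P.log_X_le
  have hlL := P.log_L_le_WL
  have hsL := P.succ_mul_L_le
  have hWL0 : 0 ≤ P.WL := by linarith [P.WL_ge_one]
  have hWL : (P.L : ℝ) * P.WL ≤ P.G * P.X * P.L / 128 := by
    have h3 := P.WL_mul_le
    have hLW : 0 ≤ (P.L : ℝ) * P.WL := by positivity
    have : (P.L : ℝ) * P.WL ≤ ((n : ℝ) + 1) * P.L * P.WL / 2 := by
      nlinarith [mul_nonneg (sub_nonneg.mpr hn) hLW]
    linarith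
  have hXL' : (P.X : ℝ) * P.L ≤ P.G * P.X * P.L / 16 := by
    rw [le_div_iff₀ (by norm_num)]
    have hXL0 : 0 ≤ (P.X : ℝ) * P.L := by positivity
    nlinarith
  have ht9 : (P.T s : ℝ) + 1 ≤ 9 * P.L := by linarith
  have hlog0 : 0 ≤ Real.log (2 * (2 ^ (ν + 1) * (P.Xs s : ℝ) + 1)) := Real.log_nonneg (by
    have : (0:ℝ) ≤ 2 ^ (ν + 1) * (P.Xs s : ℝ) := by positivity
    linarith)
  have hbr : (ν + 5) * Real.log 2 + Real.log P.X + Real.log P.L ≤ (n + 5) * (6932 / 10000) + P.X / 4 + P.WL := by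
    have : ((ν : ℝ) + 5) * Real.log 2 ≤ (n + 5) * (6932 / 10000) := by nlinarith
    linarith
  have hn5 : ((n : ℝ) + 5) * P.L ≤ 3 * (((n:ℝ) + 1) * P.L) := by nlinarith
  calc ((P.T s : ℝ) + 1) * Real.log (2 * (2 ^ (ν + 1) * (P.Xs s : ℝ) + 1))
      ≤ (9 * P.L) * ((n + 5) * (6932 / 10000) + P.X / 4 + P.WL) :=
        mul_le_mul ht9 (hlogN.trans hbr) hlog0 (by positivity)
    _ = (62388 / 10000) * ((n + 5) * P.L) + (9 / 4) * (P.X * P.L) + 9 * (P.L * P.WL) := by ring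
    _ ≤ (62388 / 10000) * (3 * (((n:ℝ) + 1) * P.L)) + (9 / 4) * (P.G * P.X * P.L / 16) +
          9 * (P.G * P.X * P.L / 128) := by linarith
    _ ≤ (25 / 100) * (P.G * P.X * P.L) := by linarith

/-- **`Acond s ν ≤ 2^ν Z/(n+1) + 0.27 Z`** for `ν ≤ n`. [folklore] -/
theorem Acond_le (s : ℕ) {ν : ℕ} (hν : ν ≤ n) :
    P.Acond s ν ≤ 2 ^ ν * (P.G * P.X * P.L) / (n + 1) + (27 / 100) * (P.G * P.X * P.L) := by
  have ha := P.Acond_nodes_le s ν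
  have hb := P.Acond_tlog_le s hν
  have hT : (P.T s : ℝ) ≤ 8 * P.L := by exact_mod_cast P.T_le s
  have hL := P.L_le_GXL
  unfold Acond
  linarith

/-! ### The master inequalities -/

/-- negligible terms: `2·yload + G + 2H + 8 ≤ Z/500`. [folklore] -/
theorem small_le : 2 * P.yload + P.G + 2 * P.H + 8 ≤ P.G * P.X * P.L / 500 := by
  have hY := P.yload_le            -- yload ≤ G L/1440
  have hH := P.H_le
  have hZ := P.GXL_ge
  have hG : 0 < P.G := by linarith [P.eight_le_G]
  have hX := P.seventytwo_le_X
  have hL := P.two_pow_25_le_L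
  have hn : (1 : ℝ) ≤ n := by exact_mod_cast P.hn
  have hGL : P.G * P.L ≤ P.G * P.X * P.L / 72 := by
    rw [le_div_iff₀ (by norm_num)]
    have : 0 ≤ P.G * P.L := by positivity
    nlinarith
  have hH' : (P.H : ℝ) ≤ P.G * P.X / 128 := by
    calc (P.H : ℝ) ≤ P.G * P.X / (64 * (n + 1)) := hH
      _ ≤ P.G * P.X / 128 := by
          apply div_le_div_of_nonneg_left (by positivity) (by norm_num)
          linarith
  have hGX : P.G * P.X ≤ P.G * P.X * P.L / 2 ^ 25 := by
    rw [le_div_iff₀ (by positivity)]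
    have : 0 ≤ P.G * P.X := by positivity
    nlinarith
  have hG' : P.G ≤ P.G * P.X * P.L / (72 * 2 ^ 25) := by
    rw [le_div_iff₀ (by positivity)]
    have := mul_le_mul hX hL (by positivity) (by positivity)
    nlinarith
  nlinarith

/-- **(B3) THE k-STEP BUDGET** (Schwarz branch, every level `s`, every stage `ν`):
`AY + logK ν + 1 ≤ zeros s ν`. [cite: Nesterenko2003, §4.2 (4.29)–(4.34)] -/
theorem kstep_budget (s ν : ℕ) : P.AY + P.logK ν + 1 ≤ P.zeros s ν := by
  have hz := P.zeros_ge s ν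
  have hAY := P.AY_le
  have hAH := P.AH_le
  have hAV := P.AV_le
  have hAW := P.AW_le
  have hl := P.lunk_le
  have hh0 := P.hts_le 0
  have hhν := P.hts_le ν
  have hsm := P.small_le
  have hZ := P.GXL_ge
  have h2ν : (1 : ℝ) ≤ 2 ^ ν := one_le_pow₀ (by norm_num)
  have hH0 : (0 : ℝ) ≤ P.H := by positivity
  have hG0 : (0 : ℝ) ≤ P.G := le_trans (by norm_num) P.sixteen_le_G
  have hZ0 : 0 ≤ P.G * P.X * P.L := by linarith
  unfold logK Acoef
  simp only [pow_zero, one_mul] at hh0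
  have hνZ : P.G * P.X * P.L ≤ 2 ^ ν * (P.G * P.X * P.L) := by nlinarith
  linarith

/-- **(B4) THE HALF-STEP BUDGET** (degree-`2ⁿ` Liouville at the points `x/2`):
`AY + 2ⁿ · (logK 0 + 1) ≤ zeros s n`. [cite: Nesterenko2003, §4.3 (4.39)–(4.45)] -/
theorem halfstep_budget (s : ℕ) : P.AY + 2 ^ n * (P.logK 0 + 1) ≤ P.zeros s n := by
  have hz := P.zeros_ge s n
  have hAY := P.AY_le
  have hAH := P.AH_le
  have hAV := P.AV_le
  have hAW := P.AW_le
  have hl := P.lunk_le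
  have hh0 := P.hts_le 0
  have hsm := P.small_le
  have hZ := P.GXL_ge
  have h2n : (2 : ℝ) ≤ 2 ^ n := by
    calc (2 : ℝ) = 2 ^ 1 := by norm_num
      _ ≤ 2 ^ n := pow_le_pow_right₀ (by norm_num) P.hn
  have hH0 : (0 : ℝ) ≤ P.H := by positivity
  have hG0 : (0 : ℝ) ≤ P.G := le_trans (by norm_num) P.sixteen_le_G
  have hY0 : 0 ≤ P.yload := P.yload_pos.le
  simp only [pow_zero, one_mul] at hh0
  have hK : P.logK 0 + 1 ≤ (509 / 100) * (P.G * P.X * P.L) := by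
    unfold logK Acoef; linarith
  have h2n0 : (0 : ℝ) ≤ 2 ^ n := by positivity
  nlinarith [mul_le_mul_of_nonneg_left hK h2n0]

/-- **(C0) THE ORDER BUDGET** (U-branch; the frame's `U` is the negated bound in height·log units):
if `8 · 2ⁿ · G X L ≤ U` then `AY + Acond s ν + 2ⁿ · (logK 0 + 1) < U` for `ν ≤ n`.
[cite: Nesterenko2003, §4.2 (4.30)–(4.31)] -/
theorem order_budget (s : ℕ) {ν : ℕ} (hν : ν ≤ n) {U : ℝ} (hU : 8 * 2 ^ n * (P.G * P.X * P.L) ≤ U) :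
    P.AY + P.Acond s ν + 2 ^ n * (P.logK 0 + 1) < U := by
  have hAY := P.AY_le
  have hAH := P.AH_le
  have hAV := P.AV_le
  have hAW := P.AW_le
  have hl := P.lunk_le
  have hh0 := P.hts_le 0
  have hsm := P.small_le
  have hZ := P.GXL_ge
  have hc := P.Acond_le s hν
  have h2n : (2 : ℝ) ≤ 2 ^ n := by
    calc (2 : ℝ) = 2 ^ 1 := by norm_num
      _ ≤ 2 ^ n := pow_le_pow_right₀ (by norm_num) P.hn
  have h2νn : (2 : ℝ) ^ ν ≤ 2 ^ n := pow_le_pow_right₀ (by norm_num) hν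
  have hn1 : (2 : ℝ) ≤ n + 1 := by
    have hn : (1 : ℝ) ≤ n := by exact_mod_cast P.hn
    linarith
  have hH0 : (0 : ℝ) ≤ P.H := by positivity
  have hG0 : (0 : ℝ) ≤ P.G := le_trans (by norm_num) P.sixteen_le_G
  have hY0 : 0 ≤ P.yload := P.yload_pos.le
  simp only [pow_zero, one_mul] at hh0
  have hK : P.logK 0 + 1 ≤ (509 / 100) * (P.G * P.X * P.L) := by
    unfold logK Acoef; linarith
  have h2n0 : (0 : ℝ) ≤ 2 ^ n := by positivity
  have hZ0 : 0 ≤ P.G * P.X * P.L := by linarith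
  -- `2^ν Z/(n+1) ≤ 2^n Z/2`
  have hdiv : 2 ^ ν * (P.G * P.X * P.L) / (n + 1) ≤ 2 ^ n * (P.G * P.X * P.L) / 2 := by
    rw [div_le_div_iff₀ (by positivity) (by norm_num)]
    have := mul_le_mul h2νn hn1 (by norm_num) h2n0
    nlinarith
  nlinarith [mul_le_mul_of_nonneg_left hK h2n0]

/-- **(C0′) the same with the unit-disc allowance `AY1`** (for the refined U-branch carrying `Bw₁`).
[cite: Nesterenko2003, §4.2 (4.30)–(4.31)] -/
theorem order_budget₁ (s : ℕ) {ν : ℕ} (hν : ν ≤ n) {U : ℝ} (hU : 8 * 2 ^ n * (P.G * P.X * P.L) ≤ U) :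
    P.AY1 + P.Acond s ν + 2 ^ n * (P.logK 0 + 1) < U := by
  have hAY1 := P.AY1_le
  have hAH := P.AH_le
  have hAV := P.AV_le
  have hAW := P.AW_le
  have hl := P.lunk_le
  have hh0 := P.hts_le 0
  have hsm := P.small_le
  have hZ := P.GXL_ge
  have hc := P.Acond_le s hν
  have h2n : (2 : ℝ) ≤ 2 ^ n := by
    calc (2 : ℝ) = 2 ^ 1 := by norm_num
      _ ≤ 2 ^ n := pow_le_pow_right₀ (by norm_num) P.hn
  have h2νn : (2 : ℝ) ^ ν ≤ 2 ^ n := pow_le_pow_right₀ (by norm_num) hν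
  have hn1 : (2 : ℝ) ≤ n + 1 := by
    have hn : (1 : ℝ) ≤ n := by exact_mod_cast P.hn
    linarith
  have hH0 : (0 : ℝ) ≤ P.H := by positivity
  have hG0 : (0 : ℝ) ≤ P.G := le_trans (by norm_num) P.sixteen_le_G
  have hY0 : 0 ≤ P.yload := P.yload_pos.le
  simp only [pow_zero, one_mul] at hh0
  have hK : P.logK 0 + 1 ≤ (509 / 100) * (P.G * P.X * P.L) := by
    unfold logK Acoef; linarith
  have h2n0 : (0 : ℝ) ≤ 2 ^ n := by positivity
  have hZ0 : 0 ≤ P.G * P.X * P.L := by linarith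
  have hdiv : 2 ^ ν * (P.G * P.X * P.L) / (n + 1) ≤ 2 ^ n * (P.G * P.X * P.L) / 2 := by
    rw [div_le_div_iff₀ (by positivity) (by norm_num)]
    have := mul_le_mul h2νn hn1 (by norm_num) h2n0
    nlinarith
  nlinarith [mul_le_mul_of_nonneg_left hK h2n0]

end PadicG3Par

end Summit.ABC.StewartYu
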